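import Mathlib
import Literature.Probability.Divergences.RenyiDivergence
import HarnessLib

/-!
# Hölder change of reference for exponential moments (crux `TwoClocks.ClampedEntropyClock`, line `IdeatorTwoSketch`, S3)

Helper (`--supports stmt-AtomisticToContinuum-15145`) for the line lead's skeleton of the crux
`Summit.AtomisticToContinuum.HydrodynamicLimit.Theses.TwoClocks.ClampedEntropyClock` (Yau's relative-entropy
clock for deterministic hard spheres), card `renyi-open-condition`: large-deviation UPPER bounds are moved
between two nearby reference laws `μ ≪ ν` at the price of an order-`q` Hellinger integral
`hellingerIntegral q μ ν = ∫ (dμ/dν)^q dν` ([VanervenHarremoes2014, Def. 2 / §II-A]).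

* `stub_lintegralExpLeOfHellinger` — for σ-finite `μ ≪ ν`, measurable `Y : Ω → ℝ` and conjugate exponents
  `1 < p`, `p⁻¹ + q⁻¹ = 1`:
  `∫⁻ e^Y dμ ≤ (∫⁻ e^{pY} dν)^{1/p} · (hellingerIntegral q μ ν)^{1/q}`.

Proof: `∫⁻ e^Y dμ = ∫⁻ (dμ/dν) · e^Y dν` (`MeasureTheory.lintegral_rnDeriv_mul`, the Lebesgue decomposition
coming from σ-finiteness), then Hölder's inequality in `ℝ≥0∞` (`ENNReal.lintegral_mul_le_Lp_mul_Lq`) with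
`f = e^Y`, `g = dμ/dν`, the pointwise identity `(e^y)^p = e^{p y}` and `hellingerIntegral_of_ac`.
Mathlib + `Literature.Probability.Divergences.RenyiDivergence` only.
-/

noncomputable section

namespace Summit.AtomisticToContinuum.HydrodynamicLimit.Theorems.QuenchedCellClock

open MeasureTheory
open scoped ENNReal
open Literature.Probability.Divergences

/-- Pointwise power of an exponential in `ℝ≥0∞`: for `0 ≤ p`,
`(ENNReal.ofReal (e^y)) ^ p = ENNReal.ofReal (e^{p y})`. [folklore] -/
theorem ofReal_exp_rpow {p : ℝ} (hp : 0 ≤ p) (y : ℝ) :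
    ENNReal.ofReal (Real.exp y) ^ p = ENNReal.ofReal (Real.exp (p * y)) := by
  rw [ENNReal.ofReal_rpow_of_nonneg (Real.exp_pos y).le hp, ← Real.exp_mul, mul_comm]

/-- **Hölder change of reference for exponential moments.** For σ-finite measures `μ ≪ ν` on `Ω`, a
measurable `Y : Ω → ℝ` and conjugate exponents `1 < p`, `p⁻¹ + q⁻¹ = 1`,
`∫⁻ e^Y dμ ≤ (∫⁻ e^{pY} dν)^{1/p} · (∫ (dμ/dν)^q dν)^{1/q}`, the last factor being the order-`q`
Hellinger integral `hellingerIntegral q μ ν`: an exponential-moment (large-deviation upper) bound under `ν`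
at rate `pβ` yields one under `μ` at rate `β`, the price being the Rényi-type cost `∫ (dμ/dν)^q dν`.
This is Hölder's inequality applied to `∫⁻ e^Y dμ = ∫⁻ (dμ/dν) · e^Y dν`.
[cite: VanervenHarremoes2014, §II-A] -/
theorem stub_lintegralExpLeOfHellinger {Ω : Type*} [MeasurableSpace Ω] (μ ν : Measure Ω)
    [SigmaFinite μ] [SigmaFinite ν] (hac : μ ≪ ν) (Y : Ω → ℝ) (hY : Measurable Y) {p q : ℝ}
    (hp : 1 < p) (hpq : p⁻¹ + q⁻¹ = 1) :
    ∫⁻ z, ENNReal.ofReal (Real.exp (Y z)) ∂μ ≤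
      (∫⁻ z, ENNReal.ofReal (Real.exp (p * Y z)) ∂ν) ^ p⁻¹ * (hellingerIntegral q μ ν) ^ q⁻¹ := by
  have hpq' : p.HolderConjugate q := Real.holderConjugate_iff.mpr ⟨hp, hpq⟩
  have hf : Measurable fun z => ENNReal.ofReal (Real.exp (Y z)) := hY.exp.ennreal_ofReal
  have hg : Measurable (μ.rnDeriv ν) := Measure.measurable_rnDeriv μ ν
  rw [hellingerIntegral_of_ac hac]
  calc ∫⁻ z, ENNReal.ofReal (Real.exp (Y z)) ∂μ
      = ∫⁻ z, μ.rnDeriv ν z * ENNReal.ofReal (Real.exp (Y z)) ∂ν :=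
        (lintegral_rnDeriv_mul hac hf.aemeasurable).symm
    _ = ∫⁻ z, ((fun z => ENNReal.ofReal (Real.exp (Y z))) * μ.rnDeriv ν) z ∂ν := by
        refine lintegral_congr fun z => ?_
        simp only [Pi.mul_apply]
        exact mul_comm _ _
    _ ≤ (∫⁻ z, ENNReal.ofReal (Real.exp (Y z)) ^ p ∂ν) ^ (1 / p) *
          (∫⁻ z, μ.rnDeriv ν z ^ q ∂ν) ^ (1 / q) :=
        ENNReal.lintegral_mul_le_Lp_mul_Lq ν hpq' hf.aemeasurable hg.aemeasurable
    _ = (∫⁻ z, ENNReal.ofReal (Real.exp (p * Y z)) ∂ν) ^ p⁻¹ *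
          (∫⁻ z, μ.rnDeriv ν z ^ q ∂ν) ^ q⁻¹ := by
        simp only [one_div, ofReal_exp_rpow hpq'.nonneg]

end Summit.AtomisticToContinuum.HydrodynamicLimit.Theorems.QuenchedCellClock

end
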